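import Literature.AnabelianGeometry.EtaleTheta.TemperedFrobenioidModel

/-!
# [EtTh] Definition 3.6 (iv): the base-field-theoretic hull `C^{bs-fld}` as a category and the
# natural functor `C^{bs-fld} → C`

Source: [MochizukiEtTh2009] §3, Definition 3.6 (iv), PDF pp.77–78 (printed 303–304): "The data
`(D, Φ^{bs-fld}, F, F → (Φ^{bs-fld})^gp)` determines a model Frobenioid `C^{bs-fld}` [cf. [FrdI], Theorem
5.2, (ii)]. Moreover, the natural inclusion `Φ^{bs-fld}(-) ⊆ Φ(-)` determines a natural faithful functor
`C^{bs-fld} → C` … We shall refer to the Frobenioid `C^{bs-fld}` obtained in this way as the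
*base-field-theoretic hull* of the tempered Frobenioid `C`."

REAL here (merge of the TODO left in `TemperedFrobenioid.lean`): the constant-function monoid of the
hull `F^{bs} := F₀^Λ|_D ×_{(Φ^{ℝ-log})^gp} (Φ^{bs-fld})^gp` as a monoid on `D` (`cnstFnBsFunctor`) with
`Div : F^{bs} → (Φ^{bs-fld})^gp` (`divFNatTrans`), the category
`hullCategory := Frobenioids.ModelFrobenioid Φ^{bs-fld} F^{bs} Div` ([FrdI] Thm 5.2 (i)), and the functor
`hull : hullCategory ⥤ category` induced by `Φ^{bs-fld} ⊆ Φ` on classes, zero divisors and units.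
Rendering note: print forms `F := F₀^Λ|_D ×_{(Φ^{ℝ-log})^gp} Φ^gp` and then says its image lies in
`(Φ^{bs-fld})^gp`; we take the fibre product with `(Φ^{bs-fld})^gp` directly (the same monoid under the
injectivity of `(Φ^{bs-fld})^gp → Φ^gp → (Φ^{ℝ-log})^gp`, which holds for the integral monoids of the
text). Faithfulness of `hull` ("a natural faithful functor") likewise rests on that injectivity and is
recorded as the named `Prop` `HullFaithful`, not asserted.
-/

namespace Literature.AnabelianGeometry.EtaleTheta

open CategoryTheory Opposite Literature.AlgebraicGeometry.Frobenioids

universe u₀ v₀ u v w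

namespace TemperedFrobenioid

variable {D₀ : Type u₀} [Category.{v₀} D₀] {V : FrdIMonoidStub.{w}}
  {T : RealifiedDivisorMonoids (D₀ := D₀) V} {D : Type u} [Category.{v} D]
  {VD : FrdICatStub.{u, v, w} D} (C : TemperedFrobenioid T D VD)

/-- Groupification homomorphisms out of `M^gp` are determined on `M`. [folklore] -/
private theorem gp_hom_ext' {M N : Type w} [CommMonoid M] [CommGroup N]
    {f₁ f₂ : Algebra.GrothendieckGroup M →* N}
    (h : ∀ m : M, f₁ (Algebra.GrothendieckGroup.of m) = f₂ (Algebra.GrothendieckGroup.of m)) :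
    f₁ = f₂ := by
  apply Algebra.GrothendieckGroup.lift.symm.injective
  rw [Algebra.GrothendieckGroup.lift_symm_apply, Algebra.GrothendieckGroup.lift_symm_apply]
  exact MonoidHom.ext h

/-- `gpMap` of (a homomorphism equal to) the identity is the identity. [folklore] -/
private theorem gpMap_eq_id' {M : Type w} [CommMonoid M] {f : M →* M} (hf : ∀ x, f x = x)
    (ξ : Algebra.GrothendieckGroup M) : gpMap f ξ = ξ := by
  have : gpMap f = MonoidHom.id _ := gp_hom_ext' fun m => by rw [gpMap_of, hf]; rfl
  rw [this, MonoidHom.id_apply]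

/-- `gpMap` is compatible with composition, pointwise. [folklore] -/
private theorem gpMap_comp_apply' {M N P : Type w} [CommMonoid M] [CommMonoid N] [CommMonoid P]
    (f : M →* N) (g : N →* P) (h : M →* P) (hfg : ∀ x, g (f x) = h x)
    (ξ : Algebra.GrothendieckGroup M) : gpMap g (gpMap f ξ) = gpMap h ξ := by
  have : (gpMap g).comp (gpMap f) = gpMap h := gp_hom_ext' fun m => by
    rw [MonoidHom.comp_apply, gpMap_of, gpMap_of, gpMap_of, hfg]
  rw [← MonoidHom.comp_apply, this]

/-! ## The inclusions `(Φ^{bs-fld}(A))^gp → Φ(A)^gp → (Φ^{ℝ-log})^gp(A)` -/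

/-- `(Φ^{bs-fld}(A))^gp → (Φ^{ℝ-log})^gp(A)`. [cite: MochizukiEtTh2009, Def 3.6 p.78] -/
noncomputable def bsFldGpToRlog (A : Dᵒᵖ) :
    Algebra.GrothendieckGroup (C.bsFld.carrier A) →* Algebra.GrothendieckGroup (T.ΦR.obj (C.baseOp A)) :=
  gpMap (C.bsFld.carrier A).subtype

/-! ## `F^{bs} = F₀^Λ|_D ×_{(Φ^{ℝ-log})^gp} (Φ^{bs-fld})^gp` and the hull category -/

/-- `F^{bs}(A)`: pairs `(b, ξ)` with `b ∈ F₀^Λ(Y_A)` a constant function and `ξ ∈ (Φ^{bs-fld}(A))^gp` with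
the same image in `(Φ^{ℝ-log})^gp(A)` — the rational-function monoid of the hull data
`(D, Φ^{bs-fld}, F, F → (Φ^{bs-fld})^gp)` (p.77–78). [cite: MochizukiEtTh2009, Def 3.6 p.78] -/
noncomputable def cnstFnBs (A : Dᵒᵖ) :
    Submonoid ((T.BΛ.obj (C.baseOp A) : Type w) × Algebra.GrothendieckGroup (C.bsFld.carrier A)) where
  carrier := {p | p.1 ∈ T.FΛ (C.baseOp A) ∧ T.divΛ (C.baseOp A) p.1 = C.bsFldGpToRlog A p.2}
  one_mem' := by
    refine ⟨(T.FΛ _).one_mem, ?_⟩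
    change T.divΛ (C.baseOp A) 1 = C.bsFldGpToRlog A 1
    rw [map_one, map_one]
  mul_mem' {p q} hp hq := by
    refine ⟨(T.FΛ _).mul_mem hp.1 hq.1, ?_⟩
    change T.divΛ (C.baseOp A) (p.1 * q.1) = C.bsFldGpToRlog A (p.2 * q.2)
    rw [map_mul, map_mul]
    exact congrArg₂ (· * ·) hp.2 hq.2

/-- Naturality of `(Φ^{bs-fld})^gp → (Φ^{ℝ-log})^gp` with respect to pull-back.
[cite: MochizukiEtTh2009, Def 3.6 p.78] -/
theorem bsFldGpToRlog_pull {A A' : Dᵒᵖ} (f : A ⟶ A') (ξ : Algebra.GrothendieckGroup (C.bsFld.carrier A)) :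
    C.bsFldGpToRlog A' (gpMap (C.bsFld.pull f) ξ) =
      gpMap (T.ΦR.map (C.base.map f.unop).op).hom (C.bsFldGpToRlog A ξ) := by
  have key : (C.bsFldGpToRlog A').comp (gpMap (C.bsFld.pull f)) =
      (gpMap (T.ΦR.map (C.base.map f.unop).op).hom).comp (C.bsFldGpToRlog A) :=
    gp_hom_ext' fun x =>
      ((congrArg (C.bsFldGpToRlog A') (gpMap_of (C.bsFld.pull f) x)).trans
        (gpMap_of (C.bsFld.carrier A').subtype (C.bsFld.pull f x))).trans
      (((congrArg (gpMap (T.ΦR.map (C.base.map f.unop).op).hom)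
        (gpMap_of (C.bsFld.carrier A).subtype x)).trans
        (gpMap_of (T.ΦR.map (C.base.map f.unop).op).hom (x : (C.base.op ⋙ T.ΦR).obj A))).symm)
  exact DFunLike.congr_fun key ξ

/-- Pull-back on `F^{bs}`, componentwise. [cite: MochizukiEtTh2009, Def 3.6 p.78] -/
noncomputable def cnstFnBsPull {A A' : Dᵒᵖ} (f : A ⟶ A') : C.cnstFnBs A →* C.cnstFnBs A' :=
  (((T.BΛ.map (C.base.map f.unop).op).hom.prodMap (gpMap (C.bsFld.pull f))).restrict (C.cnstFnBs A)).codRestrict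
    (C.cnstFnBs A') fun p => by
      refine ⟨T.FΛ_map _ _ p.2.1, ?_⟩
      change T.divΛ (C.baseOp A') ((T.BΛ.map (C.base.map f.unop).op).hom p.1.1) =
        C.bsFldGpToRlog A' (gpMap (C.bsFld.pull f) p.1.2)
      rw [T.divΛ_natural, C.bsFldGpToRlog_pull, p.2.2]

/-- `F^{bs}` as a monoid on `D`. [cite: MochizukiEtTh2009, Def 3.6 p.78] -/
noncomputable def cnstFnBsFunctor : Dᵒᵖ ⥤ CommMonCat.{w} where
  obj A := CommMonCat.of (C.cnstFnBs A)
  map f := CommMonCat.ofHom (C.cnstFnBsPull f)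
  map_id A := by
    apply CommMonCat.hom_ext
    ext p
    · change (T.BΛ.map (C.base.map (𝟙 (unop A))).op).hom p.1.1 = p.1.1
      rw [C.base.map_id, op_id, T.BΛ.map_id]
      rfl
    · change gpMap (C.bsFld.pull (𝟙 A)) p.1.2 = p.1.2
      exact gpMap_eq_id' (fun x => Subtype.ext
        ((congrArg (fun φ => CommMonCat.Hom.hom φ x.1) ((C.base.op ⋙ T.ΦR).map_id A)).trans rfl)) _
  map_comp {A A' A''} f g := by
    apply CommMonCat.hom_ext
    ext p
    · change (T.BΛ.map (C.base.map (f ≫ g).unop).op).hom p.1.1 =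
        (T.BΛ.map (C.base.map g.unop).op).hom ((T.BΛ.map (C.base.map f.unop).op).hom p.1.1)
      rw [unop_comp, C.base.map_comp, op_comp, T.BΛ.map_comp]
      rfl
    · change gpMap (C.bsFld.pull (f ≫ g)) p.1.2 = gpMap (C.bsFld.pull g) (gpMap (C.bsFld.pull f) p.1.2)
      exact (gpMap_comp_apply' _ _ _ (fun x => Subtype.ext
        (congrArg (fun φ => CommMonCat.Hom.hom φ x.1) ((C.base.op ⋙ T.ΦR).map_comp f g)).symm) _).symm

/-- `F^{bs}(A) → (Φ^{bs-fld}(A))^gp`, the second projection. [cite: MochizukiEtTh2009, Def 3.6 p.78] -/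
noncomputable def divF (A : Dᵒᵖ) : C.cnstFnBs A →* Algebra.GrothendieckGroup (C.bsFld.carrier A) :=
  (MonoidHom.snd _ _).comp (C.cnstFnBs A).subtype

/-- `F^{bs} → (Φ^{bs-fld})^gp` as a homomorphism of monoids on `D`. [cite: MochizukiEtTh2009, Def 3.6 p.78] -/
noncomputable def divFNatTrans : C.cnstFnBsFunctor ⟶ monoidGp C.bsFldMonoid where
  app A := CommMonCat.ofHom (C.divF A)
  naturality {A A'} f := by
    apply CommMonCat.hom_ext
    ext p
    change gpMap (C.bsFld.pull f) p.1.2 = MonGp.map (C.bsFld.pull f) p.1.2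
    rfl

/-- **The base-field-theoretic hull `C^{bs-fld}` as a category** (Def 3.6 (iv), p.78): the model
Frobenioid ([FrdI] Thm 5.2 (i), tree `Frobenioids.ModelFrobenioid`) of the data
`(D, Φ^{bs-fld}, F^{bs}, F^{bs} → (Φ^{bs-fld})^gp)`. [cite: MochizukiEtTh2009, Def 3.6 p.78] -/
noncomputable abbrev hullCategory : Type (max u w) :=
  ModelFrobenioid C.bsFldMonoid C.cnstFnBsFunctor C.divFNatTrans

/-! ## The natural functor `C^{bs-fld} → C` -/

/-- `Φ^{bs-fld}(A) ⊆ Φ(A)` between the values of the two monoids on `D` (types as carried by the model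
Frobenioids). [cite: MochizukiEtTh2009, Def 3.6 p.78] -/
def bsFldInclM (A : Dᵒᵖ) : (C.bsFldMonoid.obj A : Type w) →* (C.divisorMonoid.obj A : Type w) :=
  Submonoid.inclusion (C.bsFld_le A)

/-- Its groupification `(Φ^{bs-fld}(A))^gp → Φ(A)^gp`. [cite: MochizukiEtTh2009, Def 3.6 p.78] -/
noncomputable def bsFldInclGpM (A : Dᵒᵖ) :
    Algebra.GrothendieckGroup (C.bsFldMonoid.obj A) →* Algebra.GrothendieckGroup (C.divisorMonoid.obj A) :=
  gpMap (C.bsFldInclM A)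

/-- `bsFldInclGpM` on generators. [cite: MochizukiEtTh2009, Def 3.6 p.78] -/
theorem bsFldInclGpM_of (A : Dᵒᵖ) (x : C.bsFldMonoid.obj A) :
    C.bsFldInclGpM A (Algebra.GrothendieckGroup.of x) = Algebra.GrothendieckGroup.of (C.bsFldInclM A x) :=
  gpMap_of _ _

/-- `(Φ^{bs-fld})^gp → Φ^gp` commutes with the transports `Φ(f)` on groupifications (the `pullGp` of the
two model Frobenioids). [cite: MochizukiEtTh2009, Def 3.6 p.78] -/
theorem bsFldInclGpM_pullGp {X Y : D} (f : X ⟶ Y) (ξ : Algebra.GrothendieckGroup (C.bsFldMonoid.obj (op Y))) :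
    C.bsFldInclGpM (op X) (pullGp C.bsFldMonoid f ξ) = pullGp C.divisorMonoid f (C.bsFldInclGpM (op Y) ξ) := by
  have key : (C.bsFldInclGpM (op X)).comp (pullGp C.bsFldMonoid f) =
      (pullGp C.divisorMonoid f).comp (C.bsFldInclGpM (op Y)) :=
    gp_hom_ext' fun x => by
      change C.bsFldInclGpM (op X) (pullGp C.bsFldMonoid f (Algebra.GrothendieckGroup.of x)) =
        pullGp C.divisorMonoid f (C.bsFldInclGpM (op Y) (Algebra.GrothendieckGroup.of x))
      rw [pullGp_of, bsFldInclGpM_of, bsFldInclGpM_of, pullGp_of]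
      rfl
  exact DFunLike.congr_fun key ξ

/-- `(Φ^{bs-fld})^gp → Φ^gp → (Φ^{ℝ-log})^gp` is the direct map, in the types of the model Frobenioids.
[cite: MochizukiEtTh2009, Def 3.6 p.78] -/
theorem ΦgpToRlog_bsFldInclGpM (A : Dᵒᵖ) (ξ : Algebra.GrothendieckGroup (C.bsFldMonoid.obj A)) :
    C.ΦgpToRlog A (C.bsFldInclGpM A ξ) = C.bsFldGpToRlog A ξ :=
  gpMap_comp_apply' _ _ _ (fun _ => rfl) ξ

/-- The unit component of `hull`: `(b, ξ) ↦ (b, ξ ∈ Φ^gp)`, from `F^{bs}(A)` to `B(A)`.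
[cite: MochizukiEtTh2009, Def 3.6 p.78] -/
noncomputable def hullUnitM (A : Dᵒᵖ) : (C.cnstFnBsFunctor.obj A : Type w) →* (C.ratFnFunctor.obj A : Type w) :=
  (((MonoidHom.id _).prodMap (C.bsFldInclGpM A)).restrict (C.cnstFnBs A)).codRestrict (C.ratFn A) fun p => by
    change T.divΛ (C.baseOp A) p.1.1 = C.ΦgpToRlog A (C.bsFldInclGpM A p.1.2)
    rw [C.ΦgpToRlog_bsFldInclGpM, p.2.2]

/-- `hullUnitM` is natural with respect to pull-back. [cite: MochizukiEtTh2009, Def 3.6 p.78] -/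
theorem hullUnitM_natural {A A' : Dᵒᵖ} (f : A ⟶ A') (u : C.cnstFnBsFunctor.obj A) :
    C.hullUnitM A' ((C.cnstFnBsFunctor.map f).hom u) = (C.ratFnFunctor.map f).hom (C.hullUnitM A u) := by
  apply Subtype.ext
  apply Prod.ext
  · rfl
  · change C.bsFldInclGpM A' (gpMap (C.bsFld.pull f) u.1.2) = gpMap (C.Φ.pull f) (C.bsFldInclGpM A u.1.2)
    have key : (C.bsFldInclGpM A').comp (gpMap (C.bsFld.pull f)) =
        (gpMap (C.Φ.pull f)).comp (C.bsFldInclGpM A) :=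
      gp_hom_ext' fun x =>
        (((congrArg (C.bsFldInclGpM A') (gpMap_of (C.bsFld.pull f) x)).trans
            (C.bsFldInclGpM_of A' (C.bsFld.pull f x))).trans
          ((congrArg (gpMap (C.Φ.pull f)) (C.bsFldInclGpM_of A x)).trans
            (gpMap_of (C.Φ.pull f) (C.bsFldInclM A x))).symm)
    exact DFunLike.congr_fun key u.1.2

/-- **The natural functor `C^{bs-fld} → C`** "determined by the natural inclusion `Φ^{bs-fld}(-) ⊆ Φ(-)`"
(Def 3.6 (iv), p.78): identity on base objects and Frobenius degrees, the inclusion on classes, zero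
divisors and unit components. [cite: MochizukiEtTh2009, Def 3.6 p.78] -/
noncomputable def hull : C.hullCategory ⥤ C.category where
  obj X := ⟨X.base, C.bsFldInclGpM _ X.cls⟩
  map {X Y} φ :=
    { degFr := φ.degFr
      base := φ.base
      div := C.bsFldInclM _ φ.div
      unit := C.hullUnitM _ φ.unit
      rel := by
        have h := congrArg (C.bsFldInclGpM (op X.base)) φ.rel
        rw [map_mul, map_pow, map_mul, bsFldInclGpM_of, bsFldInclGpM_pullGp] at h
        exact h }
  map_id X := by
    apply ModelFrobenioid.hom_ext
    · rfl
    · rfl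
    · rfl
    · exact map_one (C.hullUnitM _)
  map_comp {X Y Z} φ ψ := by
    apply ModelFrobenioid.hom_ext
    · rfl
    · rfl
    · change C.bsFldInclM _ ((C.bsFldMonoid.map φ.base.op).hom ψ.div * φ.div ^ (ψ.degFr : ℕ)) =
        (C.divisorMonoid.map φ.base.op).hom (C.bsFldInclM _ ψ.div) * (C.bsFldInclM _ φ.div) ^ (ψ.degFr : ℕ)
      rw [map_mul, map_pow]
      rfl
    · change C.hullUnitM _ ((C.cnstFnBsFunctor.map φ.base.op).hom ψ.unit * φ.unit ^ (ψ.degFr : ℕ)) =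
        (C.ratFnFunctor.map φ.base.op).hom (C.hullUnitM _ ψ.unit) * (C.hullUnitM _ φ.unit) ^ (ψ.degFr : ℕ)
      rw [map_mul, map_pow, hullUnitM_natural]

/-- `hull` commutes with the projections to `D`. [cite: MochizukiEtTh2009, Def 3.6 p.78] -/
theorem hull_comp_baseFunctor :
    C.hull ⋙ C.baseFunctorOfCategory =
      ModelFrobenioid.baseFunctor C.bsFldMonoid C.cnstFnBsFunctor C.divFNatTrans := rfl

/-- "a natural **faithful** functor `C^{bs-fld} → C`" (p.78) — as a named `Prop` (it rests on the
injectivity of `(Φ^{bs-fld})^gp → Φ^gp`, automatic for the integral monoids of the text, not for the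
abstract data). [cite: MochizukiEtTh2009, Def 3.6 p.78] -/
def HullFaithful : Prop := C.hull.Faithful

end TemperedFrobenioid

end Literature.AnabelianGeometry.EtaleTheta
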